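import Summits.CriticalPhenomena.PercolationContinuityZ3.Theorems.FK.FreeBoxMagnetizationDensity
import Summits.CriticalPhenomena.PercolationContinuityZ3.Theorems.FK.ConvexLimitSlopes
import Literature.Probability.LatticeModels.IsingThermodynamicsProofs
import Literature.Probability.LatticeModels.IsingFieldGKS
import Mathlib.Analysis.Convex.Continuous
import HarnessLib

/-!
# THE MAGNETISATION IS THE FIELD-DERIVATIVE OF THE PRESSURE: `∂ψ/∂h (β,h) = β m(β,h)` for `h ≠ 0`, `ψ(β,·) ∈ C¹` off
# `h = 0`, `∂⁺ψ/∂h (β,0) = β m*(β)`, and `ψ(β,·)` is differentiable at `h = 0` iff `m*(β) = 0`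
# (Friedli–Velenik 2017, Prop. 3.29, Thm. 3.34 (2), Thm. 3.43; WITHOUT Lee–Yang)

Claimed R42 (8)(c) in the cell INBOX at 2026-08-28T22:45:16Z by fkp-10a gen 356 (NEW CLAIM #2 of the gen), addressed to coordinator fk-4 gen 283 (seated 21:31Z 2026-08-28 by l.8554; R157 in force); lineage row FO-10a-g356p (self-suggested), package g356-pressure, label PD-C.
Helper file of the `fk-continuity` build cell (bschramm lane; `--supports stmt-CriticalPhenomena-4575`); builds on
p205010 (kernel theorem, internal audit signed; external expert review pending). No definitions, no named facts, no
sorries; standard axioms. UNCONDITIONAL (nearest-neighbour Ising model on `ℤ^d`, `d ≥ 1`; the tree's parametrisation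
couples the field as `βh`, whence the factor `β`).

`ψ(β,h) = pressure d β h` is the box limit of `ψ^∅_Λ = |Λ|⁻¹ log Z^∅_{Λ;β,h}` (tree theorem `hasBoxLimit_pressureIn_holds`).
In finite volume `h ↦ log Z^{bc}_{Λ;β,h}` is convex with derivative `β Σ_{x∈Λ} ⟨σ_x⟩_{Λ;β,h}` (tree:
`convexOn_log_fieldZ_ray`, `hasDerivAt_log_isingPartitionFunction_field`); the free magnetisation density converges to
`m(β,h)` for `h > 0` (`FreeBoxMagnetizationDensity`). The convex slope sandwich (`ConvexLimitSlopes`) then gives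
`β m(β,h) ≤ (ψ(h') − ψ(h))/(h' − h) ≤ β m(β,h')` for `0 < h < h'`, and since `m(β,·)` is CONTINUOUS on `(0,∞)` (it is
concave there by GHS — `concaveOn_magnetizationInField`) and right-continuous at `0` with `m(β,0⁺) = m*(β)`:

* `convexOn_pressure_field` — `h ↦ ψ(β,h)` is convex on `ℝ` (every `β`); `pressure_neg_field` — `ψ(β,−h) = ψ(β,h)`;
* **`hasDerivAt_pressure_field`** — for `β ≥ 0` and EVERY `h > 0`: `HasDerivAt (ψ(β,·)) (β m(β,h)) h` — the pressure is
  differentiable in the field at every `h ≠ 0` with `∂ψ/∂h = β m(β,h)` (Friedli–Velenik Thm. 3.43 / Cor. 3.44 obtain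
  this from the Lee–Yang theorem; here from GHS concavity alone), `hasDerivAt_pressure_field_of_neg` (`h < 0`),
  `deriv_pressure_field`, `continuousOn_deriv_pressure_Ioi` (`ψ(β,·) ∈ C¹((0,∞))`);
* **`hasDerivWithinAt_pressure_field_zero`** — **Friedli–Velenik Prop. 3.29**: `∂⁺ψ/∂h (β,0) = β m*(β)`, and by symmetry
  `hasDerivWithinAt_pressure_field_zero_left`: `∂⁻ψ/∂h (β,0) = −β m*(β)`;
* **`differentiableAt_pressure_zero_iff`** — **Friedli–Velenik Thm. 3.34 (2) ⇔ (3)**: for `β > 0`, `ψ(β,·)` is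
  differentiable at `h = 0` iff `m*(β) = 0`; hence (`d ≥ 2`) differentiable at `0` for `β ≤ β_c`
  (`differentiableAt_pressure_zero_of_le_criticalBeta`, using the tree's `m*(β_c) = 0`) and NOT differentiable for
  `β > β_c` (`not_differentiableAt_pressure_zero_of_criticalBeta_lt`): the first-order transition in `h` at `h = 0`.

## References

* S. Friedli, Y. Velenik, *Statistical Mechanics of Lattice Systems*, CUP (2017), §3.2.3 eq. (3.7)–(3.9), Prop. 3.29,
  Thm. 3.34, Thm. 3.43, Cor. 3.44. [FriedliVelenik2017]
* R. S. Ellis, *Entropy, Large Deviations, and Statistical Mechanics*, Springer (1985/2006), Thm. V.4.3, Lemma V.4.5,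
  Thm. V.7.2 proof. [Ellis2006]
* R. B. Griffiths, C. A. Hurst, S. Sherman, J. Math. Phys. 11 (1970) 790–795. [GriffithsHurstSherman1970]
-/

noncomputable section

namespace Summit.CriticalPhenomena.PercolationContinuityZ3.Theorems.FK

namespace IsingSusceptibility

open MeasureTheory Filter Topology Finset Set
open Literature.Probability.LatticeModels
open Summit.CriticalPhenomena.PercolationContinuityZ3.Theorems.FK.ConcaveLimit

variable {d : ℕ}

/-! ### Finite volume: convexity and the field-derivative of the pressure -/

section FiniteVolume

variable {V : Type*} (G : SimpleGraph V) [DecidableEq V] [G.LocallyFinite]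

/-- **`d/dh ψ^{bc}_Λ(β,h) = β |Λ|⁻¹ Σ_{x∈Λ} ⟨σ_x⟩^{bc}_{Λ;β,h}`** (Friedli–Velenik 2017, eq. (3.7): `m_Λ = ∂ψ_Λ/∂h`, in the
tree's parametrisation). [cite: FriedliVelenik2017, §3.2.3 eq. (3.7) and Prop. 3.29 (proof)] -/
theorem hasDerivAt_pressureIn_field (Λ : Finset V) (β h : ℝ) (bc : BoundaryCondition V) :
    HasDerivAt (fun t => pressureIn G Λ β t bc) (β * ((∑ x ∈ Λ, isingCorr G Λ β h bc {x}) / #Λ)) h := by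
  unfold pressureIn
  have := (hasDerivAt_log_isingPartitionFunction_field G Λ β h bc).div_const (#Λ : ℝ)
  rwa [mul_div_assoc] at this

/-- **`h ↦ log Z^{bc}_{Λ;β,h}` is convex** (every `β`, every boundary condition; Friedli–Velenik Lemma 3.5 — a cumulant
generating function; the tree's `convexOn_log_fieldZ_ray` along the constant ray). [cite: FriedliVelenik2017, Lemma 3.5] -/
theorem convexOn_log_isingPartitionFunction_field (Λ : Finset V) (β : ℝ) (bc : BoundaryCondition V) :
    ConvexOn ℝ univ (fun h => Real.log (isingPartitionFunction G Λ β h bc)) := by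
  have hray : ∀ s : ℝ, affCpl (fun _ : V => (0 : ℝ)) (fun _ => (1 : ℝ)) s = fun _ => s := fun s => by
    funext x; simp [affCpl]
  refine (convexOn_log_fieldZ_ray G Λ β (fun _ => (0 : ℝ)) (fun _ => (1 : ℝ)) bc).congr fun s _ => ?_
  simp only [hray, fieldZ_const]

/-- **`h ↦ ψ^{bc}_Λ(β,h)` is convex** (Friedli–Velenik Lemma 3.5). [cite: FriedliVelenik2017, Lemma 3.5] -/
theorem convexOn_pressureIn_field (Λ : Finset V) (β : ℝ) (bc : BoundaryCondition V) :
    ConvexOn ℝ univ (fun h => pressureIn G Λ β h bc) := by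
  have := (convexOn_log_isingPartitionFunction_field G Λ β bc).smul (inv_nonneg.2 (Nat.cast_nonneg (#Λ)) : (0 : ℝ) ≤ (#Λ : ℝ)⁻¹)
  refine this.congr fun h _ => ?_
  simp only [pressureIn, smul_eq_mul]
  ring

/-- **Spin-flip symmetry of the partition function**: `Z⁻_{Λ;β,−h} = Z⁺_{Λ;β,h}` (Friedli–Velenik §3.7.1; the tree's
`fieldZ_fixed_neg`). [cite: FriedliVelenik2017, §3.7.1] -/
theorem isingPartitionFunction_minus_neg_field (Λ : Finset V) (β h : ℝ) :
    isingPartitionFunction G Λ β (-h) .minus = isingPartitionFunction G Λ β h .plus := by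
  rw [← fieldZ_const, ← fieldZ_const]
  exact fieldZ_fixed_neg G Λ β (fun _ => h) 1

end FiniteVolume

/-! ### Convexity and evenness of `h ↦ ψ(β,h)` -/

/-- **`h ↦ ψ(β,h)` IS CONVEX ON `ℝ`** (every `β`; Friedli–Velenik Thm. 3.6 / Lemma 3.5 in the limit).
[cite: FriedliVelenik2017, Thm. 3.6 and Lemma 3.5] -/
theorem convexOn_pressure_field (β : ℝ) : ConvexOn ℝ univ (fun h => pressure d β h) :=
  convexOn_of_tendsto convex_univ (f := fun (L : ℕ) (h : ℝ) => pressureIn (zdGraph d) (box d L) β h .free)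
    (fun L => convexOn_pressureIn_field (zdGraph d) (box d L) β .free) fun h _ =>
      (hasBoxLimit_pressureIn_holds (d := d) β h .free :)

/-- **`ψ(β,·)` is continuous** (a convex function on `ℝ`). [cite: FriedliVelenik2017, Thm. 3.6] -/
theorem continuous_pressure_field (β : ℝ) : Continuous fun h => pressure d β h := by
  have := (convexOn_pressure_field (d := d) β).continuousOn_interior
  rw [interior_univ] at this
  exact continuousOn_univ.1 this

/-- **`ψ(β,−h) = ψ(β,h)`** (spin flip: the `−` boundary condition at `−h` has the partition function of the `+` boundary
condition at `h`, and the pressure does not depend on the boundary condition). [cite: FriedliVelenik2017, §3.7.1 and Thm. 3.6] -/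
theorem pressure_neg_field (β h : ℝ) : pressure d β (-h) = pressure d β h := by
  have hminus : Tendsto (fun L : ℕ => pressureIn (zdGraph d) (box d L) β (-h) .minus) atTop (𝓝 (pressure d β (-h))) :=
    hasBoxLimit_pressureIn_holds (d := d) β (-h) .minus
  have hplus : Tendsto (fun L : ℕ => pressureIn (zdGraph d) (box d L) β h .plus) atTop (𝓝 (pressure d β h)) :=
    hasBoxLimit_pressureIn_holds (d := d) β h .plus
  refine tendsto_nhds_unique hminus ?_
  have heq : (fun L : ℕ => pressureIn (zdGraph d) (box d L) β (-h) .minus) =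
      fun L : ℕ => pressureIn (zdGraph d) (box d L) β h .plus := funext fun L => by
    simp only [pressureIn, isingPartitionFunction_minus_neg_field]
  rw [heq]
  exact hplus

/-! ### The chord sandwich `β m(β,h) ≤ (ψ(h') − ψ(h))/(h' − h) ≤ β m(β,h')` -/

/-- **Lower chord bound**: for `d ≥ 1`, `β ≥ 0`, `0 < h < h'`, `β m(β,h) ≤ slope (ψ(β,·)) h h'`.
[cite: FriedliVelenik2017, Prop. 3.29 (proof) and Thm. 3.43] -/
theorem mul_magnetizationInField_le_slope_pressure (hd : 1 ≤ d) {β : ℝ} (hβ : 0 ≤ β) {h h' : ℝ} (hh : 0 < h)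
    (hhh' : h < h') : β * magnetizationInField d β h ≤ slope (fun t => pressure d β t) h h' :=
  le_slope_of_tendsto_deriv_convex (S := univ) (f := fun (L : ℕ) (t : ℝ) => pressureIn (zdGraph d) (box d L) β t .free)
    (fun L => convexOn_pressureIn_field (zdGraph d) (box d L) β .free)
    (fun t _ => (hasBoxLimit_pressureIn_holds (d := d) β t .free :))
    (mem_univ h) (fun L => hasDerivAt_pressureIn_field (zdGraph d) (box d L) β h .free)
    ((tendsto_boxAverage_isingCorr_free_singleton hd hβ hh).const_mul β) (mem_univ h') hhh'

/-- **Upper chord bound**: for `d ≥ 1`, `β ≥ 0`, `h < h'`, `0 < h'`, `slope (ψ(β,·)) h h' ≤ β m(β,h')`.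
[cite: FriedliVelenik2017, Prop. 3.29 (proof) and Thm. 3.43] -/
theorem slope_pressure_le_mul_magnetizationInField (hd : 1 ≤ d) {β : ℝ} (hβ : 0 ≤ β) {h h' : ℝ} (hhh' : h < h')
    (hh' : 0 < h') : slope (fun t => pressure d β t) h h' ≤ β * magnetizationInField d β h' :=
  slope_le_of_tendsto_deriv_convex (S := univ) (f := fun (L : ℕ) (t : ℝ) => pressureIn (zdGraph d) (box d L) β t .free)
    (fun L => convexOn_pressureIn_field (zdGraph d) (box d L) β .free)
    (fun t _ => (hasBoxLimit_pressureIn_holds (d := d) β t .free :))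
    (mem_univ h') (fun L => hasDerivAt_pressureIn_field (zdGraph d) (box d L) β h' .free)
    ((tendsto_boxAverage_isingCorr_free_singleton hd hβ hh').const_mul β) (mem_univ h) hhh'

/-! ### THE MAGNETISATION IS THE DERIVATIVE OF THE PRESSURE -/

/-- **FRIEDLI–VELENIK THM. 3.43 / COR. 3.44 WITHOUT LEE–YANG: THE PRESSURE IS DIFFERENTIABLE IN THE FIELD AT EVERY
`h > 0`, WITH `∂ψ/∂h (β,h) = β m(β,h)`** (`d ≥ 1`, `β ≥ 0`): the chords are squeezed between `β m(β,h)` and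
`β m(β,h')`, and `m(β,·)` is continuous at `h`. [cite: FriedliVelenik2017, Thm. 3.43 and Cor. 3.44; Ellis2006, Thm. V.4.3] -/
theorem hasDerivAt_pressure_field (hd : 1 ≤ d) {β : ℝ} (hβ : 0 ≤ β) {h : ℝ} (hh : 0 < h) :
    HasDerivAt (fun t => pressure d β t) (β * magnetizationInField d β h) h := by
  -- `m(β,·)` is continuous at `h > 0`: concave on `[0,∞)` by GHS (`concaveOn_magnetizationInField`)
  have hma : ContinuousAt (fun t => magnetizationInField d β t) h :=
    (concaveOn_magnetizationInField (d := d) hβ).continuousOn_interior.continuousAt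
      (by rw [interior_Ici]; exact Ioi_mem_nhds hh)
  have hcont := hma.tendsto.const_mul β
  refine hasDerivAt_of_slope_squeeze_convex (u := fun y => β * magnetizationInField d β y)
    (v := fun y => β * magnetizationInField d β y) ?_ ?_ (hcont.mono_left nhdsWithin_le_nhds) ?_ ?_
    (hcont.mono_left nhdsWithin_le_nhds)
  · filter_upwards [self_mem_nhdsWithin] with y hy
    exact mul_magnetizationInField_le_slope_pressure hd hβ hh hy
  · filter_upwards [self_mem_nhdsWithin] with y hy
    exact slope_pressure_le_mul_magnetizationInField hd hβ hy (hh.trans hy)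
  · filter_upwards [Ioo_mem_nhdsLT hh] with y hy
    exact mul_magnetizationInField_le_slope_pressure hd hβ hy.1 hy.2
  · filter_upwards [Ioo_mem_nhdsLT hh] with y hy
    exact slope_pressure_le_mul_magnetizationInField hd hβ hy.2 hh

/-- **`deriv (ψ(β,·)) h = β m(β,h)`** for `h > 0`. [cite: FriedliVelenik2017, Cor. 3.44] -/
theorem deriv_pressure_field (hd : 1 ≤ d) {β : ℝ} (hβ : 0 ≤ β) {h : ℝ} (hh : 0 < h) :
    deriv (fun t => pressure d β t) h = β * magnetizationInField d β h :=
  (hasDerivAt_pressure_field hd hβ hh).deriv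

/-- **`h < 0` by symmetry**: `∂ψ/∂h (β,h) = −β m(β,−h)` for `h < 0` (`ψ(β,·)` is even).
[cite: FriedliVelenik2017, §3.7.1 and Cor. 3.44] -/
theorem hasDerivAt_pressure_field_of_neg (hd : 1 ≤ d) {β : ℝ} (hβ : 0 ≤ β) {h : ℝ} (hh : h < 0) :
    HasDerivAt (fun t => pressure d β t) (-(β * magnetizationInField d β (-h))) h := by
  have hneg : HasDerivAt (fun t => pressure d β t) (β * magnetizationInField d β (-h)) (-h) :=
    hasDerivAt_pressure_field hd hβ (neg_pos.2 hh)
  have hcomp := hneg.comp h (hasDerivAt_neg h)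
  have hfun : ((fun t => pressure d β t) ∘ Neg.neg) = fun t => pressure d β t :=
    funext fun t => pressure_neg_field (d := d) β t
  rw [hfun] at hcomp
  simpa using hcomp

/-- **`ψ(β,·) ∈ C¹((0,∞))`**: the derivative `β m(β,·)` is continuous on `(0,∞)`. [cite: FriedliVelenik2017, Cor. 3.44] -/
theorem continuousOn_deriv_pressure_Ioi (hd : 1 ≤ d) {β : ℝ} (hβ : 0 ≤ β) :
    ContinuousOn (deriv fun t => pressure d β t) (Ioi 0) := by
  have hm : ContinuousOn (fun t => β * magnetizationInField d β t) (Ioi 0) := by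
    have := (concaveOn_magnetizationInField (d := d) hβ).continuousOn_interior
    rw [interior_Ici] at this
    exact this.const_smul β
  exact hm.congr fun h hh => deriv_pressure_field hd hβ hh

/-! ### At `h = 0`: Prop. 3.29 and the differentiability criterion -/

/-- **FRIEDLI–VELENIK PROP. 3.29: `∂⁺ψ/∂h (β,0) = β m*(β)`** (`d ≥ 1`, `β ≥ 0`): the right chords at `0` lie between
`β m*(β)` (monotonicity of `m(β,·)` and continuity of `ψ`) and `β m(β,h') → β m*(β)` (right-continuity of the plus state).
[cite: FriedliVelenik2017, Prop. 3.29] -/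
theorem hasDerivWithinAt_pressure_field_zero (hd : 1 ≤ d) {β : ℝ} (hβ : 0 ≤ β) :
    HasDerivWithinAt (fun t => pressure d β t) (β * spontaneousMagnetization d β) (Ici 0) 0 := by
  rw [← hasDerivWithinAt_Ioi_iff_Ici]
  -- right-continuity `m(β,h') → m*(β)` as `h' ↓ 0`
  have hright : Tendsto (fun y => β * magnetizationInField d β y) (𝓝[>] 0) (𝓝 (β * spontaneousMagnetization d β)) := by
    have hm : ∀ y, magnetizationInField d β y = plusCorr d β y {0} := fun y => by
      simp only [magnetizationInField, plusCorr, spinProduct_singleton]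
    have h0 : spontaneousMagnetization d β = plusCorr d β 0 {0} := by rw [← magnetizationInField_zero, hm]
    simp only [hm, h0]
    exact (((plusCorr_continuousWithinAt_Ici_field (d := d) hβ {0} le_rfl).tendsto).mono_left
      (nhdsWithin_mono _ Ioi_subset_Ici_self)).const_mul β
  refine hasDerivWithinAt_Ioi_of_slope_squeeze_convex (u := fun y => β * magnetizationInField d β y) ?_ ?_ hright
  · -- lower bound: `β m* ≤ slope ψ 0 y`, from `β m* ≤ β m(y') ≤ slope ψ y' y` for `0 < y' < y` and `y' ↓ 0`
    filter_upwards [self_mem_nhdsWithin] with y hy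
    have hψ : ContinuousAt (fun t => pressure d β t) 0 := (continuous_pressure_field (d := d) β).continuousAt
    have hlim : Tendsto (fun y' => slope (fun t => pressure d β t) y' y) (𝓝[>] 0)
        (𝓝 (slope (fun t => pressure d β t) 0 y)) := by
      simp only [slope_def_field]
      exact ((tendsto_const_nhds.sub (hψ.tendsto.mono_left nhdsWithin_le_nhds)).div
        (tendsto_const_nhds.sub ((continuous_id.tendsto 0).mono_left nhdsWithin_le_nhds)) (sub_ne_zero.2 hy.ne'))
    refine ge_of_tendsto hlim ?_
    filter_upwards [Ioo_mem_nhdsGT hy] with y' hy'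
    calc β * spontaneousMagnetization d β = β * magnetizationInField d β 0 := by rw [magnetizationInField_zero]
      _ ≤ β * magnetizationInField d β y' :=
          mul_le_mul_of_nonneg_left (monotoneOn_magnetizationInField hβ (mem_Ici.2 le_rfl) (mem_Ici.2 hy'.1.le) hy'.1.le) hβ
      _ ≤ slope (fun t => pressure d β t) y' y := mul_magnetizationInField_le_slope_pressure hd hβ hy'.1 hy'.2
  · filter_upwards [self_mem_nhdsWithin] with y hy
    exact slope_pressure_le_mul_magnetizationInField hd hβ hy hy

/-- **`∂⁻ψ/∂h (β,0) = −β m*(β)`** (evenness of `ψ(β,·)`). [cite: FriedliVelenik2017, Prop. 3.29 and §3.7.1] -/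
theorem hasDerivWithinAt_pressure_field_zero_left (hd : 1 ≤ d) {β : ℝ} (hβ : 0 ≤ β) :
    HasDerivWithinAt (fun t => pressure d β t) (-(β * spontaneousMagnetization d β)) (Iic 0) 0 := by
  have hr : HasDerivWithinAt (fun t => pressure d β t) (β * spontaneousMagnetization d β) (Ici (-(0 : ℝ))) (-(0 : ℝ)) := by
    simpa using hasDerivWithinAt_pressure_field_zero (d := d) hd hβ
  have hneg : HasDerivWithinAt (fun t : ℝ => -t) (-1) (Iic (0 : ℝ)) 0 := (hasDerivAt_neg (0 : ℝ)).hasDerivWithinAt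
  have hcomp := hr.comp (0 : ℝ) hneg fun t (ht : t ≤ 0) => show -0 ≤ -t by simpa using ht
  have hfun : ((fun t => pressure d β t) ∘ fun t : ℝ => -t) = fun t => pressure d β t :=
    funext fun t => pressure_neg_field (d := d) β t
  rw [hfun] at hcomp
  simpa using hcomp

/-- **FRIEDLI–VELENIK THM. 3.34, (2) ⇔ (3): `ψ(β,·)` IS DIFFERENTIABLE AT `h = 0` IFF `m*(β) = 0`** (`d ≥ 1`, `β > 0`):
the one-sided derivatives at `0` are `±β m*(β)`. [cite: FriedliVelenik2017, Thm. 3.34 and Prop. 3.29] -/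
theorem differentiableAt_pressure_zero_iff (hd : 1 ≤ d) {β : ℝ} (hβ : 0 < β) :
    DifferentiableAt ℝ (fun t => pressure d β t) 0 ↔ spontaneousMagnetization d β = 0 := by
  have hR := hasDerivWithinAt_pressure_field_zero (d := d) hd hβ.le
  have hL := hasDerivWithinAt_pressure_field_zero_left (d := d) hd hβ.le
  constructor
  · intro hdiff
    have h1 : deriv (fun t => pressure d β t) 0 = β * spontaneousMagnetization d β :=
      (uniqueDiffOn_Ici (0 : ℝ) 0 self_mem_Ici).eq_deriv _ hdiff.hasDerivAt.hasDerivWithinAt hR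
    have h2 : deriv (fun t => pressure d β t) 0 = -(β * spontaneousMagnetization d β) :=
      (uniqueDiffOn_Iic (0 : ℝ) 0 self_mem_Iic).eq_deriv _ hdiff.hasDerivAt.hasDerivWithinAt hL
    have : β * spontaneousMagnetization d β = 0 := by linarith
    rcases mul_eq_zero.1 this with h | h
    · exact absurd h hβ.ne'
    · exact h
  · intro hm
    rw [hm, mul_zero] at hR
    rw [hm, mul_zero, neg_zero] at hL
    have := hL.union hR
    rw [Iic_union_Ici, hasDerivWithinAt_univ] at this
    exact this.differentiableAt

/-- **No first-order transition in `h` at `h = 0` for `β ≤ β_c`** (`d ≥ 2`; `m*(β) = 0` there — tree theorem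
`spontaneousMagnetization_eq_zero_of_le_criticalBeta_two_le`, including `β = β_c`): `ψ(β,·)` is differentiable at `0`,
with derivative `0`. [cite: FriedliVelenik2017, Thm. 3.34; AizenmanDuminilCopinSidoraviciusCMP2015, Thm. 1.2] -/
theorem differentiableAt_pressure_zero_of_le_criticalBeta (hd : 2 ≤ d) {β : ℝ} (hβ : 0 < β) (hβc : β ≤ criticalBeta d) :
    DifferentiableAt ℝ (fun t => pressure d β t) 0 :=
  (differentiableAt_pressure_zero_iff (by omega) hβ).2 (spontaneousMagnetization_eq_zero_of_le_criticalBeta_two_le hd hβ.le hβc)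

/-- **The first-order transition in `h` for `β > β_c`** (`d ≥ 2`; `m*(β) > 0` — tree theorem
`spontaneousMagnetization_pos_of_criticalBeta_lt_holds`): `ψ(β,·)` is NOT differentiable at `h = 0`; its one-sided
derivatives are `±β m*(β) ≠ 0`. [cite: FriedliVelenik2017, Thm. 3.34 and Def. 3.27] -/
theorem not_differentiableAt_pressure_zero_of_criticalBeta_lt (hd : 2 ≤ d) {β : ℝ} (hβc : criticalBeta d < β) :
    ¬ DifferentiableAt ℝ (fun t => pressure d β t) 0 := by
  have hβ : 0 < β := (criticalBeta_pos_holds hd).trans hβc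
  rw [differentiableAt_pressure_zero_iff (by omega) hβ]
  exact (spontaneousMagnetization_pos_of_criticalBeta_lt_holds (d := d) hd hβc).ne'

end IsingSusceptibility

end Summit.CriticalPhenomena.PercolationContinuityZ3.Theorems.FK

end
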